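import Literature.MathematicalPhysics.QuantumFieldTheory.Balaban1983to89.B15LeafKnitRepr
import Literature.MathematicalPhysics.QuantumFieldTheory.Balaban1983to89.B15FibreLemmaSupp

/-!
# `Balaban1983to89.B15LeafKnitMass` — [Balaban1989LargeFieldI] (0.2)–(0.6) p. 176 at the N12 knit with the p. 176 provisos in their SATISFIABLE,
# INTEGRATED form: «the densities are positive, and the in[t]egration domains … are nonempty, hence the denominators are positive» READ AS POSITIVE
# MASS `0 < ∫dV ρ(Z, V)` of every piece — (0.4), (0.6), the B15 leaf and the leaf at definer ₇'s representation data re-issued on that proviso;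
# and the located census fact that the POINTWISE proviso «`∫dV⌈_{Z′}ρ(Z″, V) ≠ 0` for EVERY field `V`» carried so far by the whole (0.3) chain is
# REFUTED by any piece vanishing on one fibre (as Bałaban's pieces `χ_k(Ω_k)·𝐓_k e^{A_k}` do at a field with a large plaquette variable in `Ω_k`
# away from `Z′`)

statement-level bookkeeping over published theorems with citation tags; kernel-checked compositions of tree theorems;
nothing here is a claim about the Yang–Mills mass gap.

CITATION HEADER (lean-in-tree rule).  Source: T. Bałaban, *Large field renormalization. I. The basic step of the 𝐑 operation*, Commun. Math.
Phys. **122**, 175–202 (1989) [Balaban1989LargeFieldI] (cell paper B15 = «[IV]»): (0.2)–(0.6) p. 176 (ll. 14–16 for the provisos), Proposition 1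
(1.78) p. 194, (1.80) p. 195, (1.89) p. 198, (1.102) p. 201; with [Balaban1988Convergent] ((2.17)–(2.18) p. 257: the pieces are products of
characteristic functions `χ_k(Ω_k)` with `𝐓_k e^{A_k}`).  Seat `pub-ymgap-dag-n12-a` (YM-PLAN Track A, HUMAN RULING D-0062: the KNIT-BY-NAME seat of node
N12), module 9 of the seat (g2).  BY NAME and UNCHANGED: `…B15LeafKnit ∕ B15LeafKnitExp ∕ B15LeafKnitRecord7` (this seat: `knitRData`, `KnitData`,
`knitW15`, `KnitData.logExp`, `b15Leaf_knit_of`, `expForm06_of_hyp05_image`, `quotSum_eq_zero_of_forall_ne`, `b15_main_of_refines₅C_of_leaf`),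
`…B15LeafKnitRepr` (module 8: `knitOfRepr`, `WOfRepr`), `…Node00.RStepRepr218`
(definer ₇: `rterm`), `…B15Norm1102Object` (r12: `integral_fibreIntegral`, `fibreIntegral_nonneg`, `fibreIntegral_le`, `measurable_fibreIntegral`, `fibreIntegral_update_self`),
`…B15BasicStep` (b01: `fibreIntegral`), `…B15Eq06Resum` (r12: `quot03`, `quotSum`), `…B15RopTotal` (dag-n12-b: `RepData`), `…DagBinding`.

WHY THIS FILE (located census finding of this seat, g2).  Every (0.3)∕(0.4) theorem of the tree's [IV] chain displays the p. 176 proviso in the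
POINTWISE form `hden : ∀ Z V, fibreIntegral (fib Z) (piece (pp Z)) V ≠ 0` — «the denominator fibre integral `∫dV⌈_{Z′}ρ(Z″, ·)` vanishes at NO field»:
b01's `B15.BasicStep.integral_ropReal_eq`, dag-n12-b's `B15RopTotal.RepData.Provisos` (hence definer ₇'s `TowerProvisos`, `Admissible`, the (0.3) branch
of `ROp03OfRecord`, and FILE 7's `integral_rop_rstepOfSel`), this seat's `normalization04_knit ∕ b15Leaf_knit_of ∕ …_at_repData ∕ b15Leaf_WOfRepr_of` (and
the numerator twin `hnum` of the `logExp` pin).  At Bałaban's pieces that form is UNSATISFIABLE: a piece `ρ(Z″, ·) = Σ_a χ_k(Ω_k(a))·(𝐓_k e^{A_k})(a)`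
([III] (2.17)–(2.18)) carries the small-field characteristic function of `Ω_k(a) ⊇ Z″ᶜ`, which does not depend on the integrated variables `V⌈_{Z′}`
away from `Z′` and VANISHES at every field with one large plaquette variable there — so the fibre integral vanishes at such a field (§1:
`fibreIntegral_eq_zero_of_vanish`, `not_forall_fibreIntegral_ne_zero`).  Print's sentence (p. 176 ll. 14–16) asserts positivity of the denominators
of the terms THAT OCCUR («the integration domains … are nonempty»), and for the SCALAR reading of (0.3) that the DAG binding types (`B15.RData.IntOver`
is a NUMBER — cell DIVERGENCE D-b01.1: `∫dV⌈_{Z′}` followed by `∫dV`) the proviso that (0.4) and (0.6) actually use is exactly POSITIVE MASS of the pieces,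
`0 < ∫dV ρ(Z, V)`: the averaged denominator `∫dV ∫dV⌈_{Z′} ρ(Z″, ·) = ∫dV ρ(Z″, ·)` (r12's `integral_fibreIntegral`) is then positive, which is all
`normalization04_knit` needed `hden` for.  This module RE-ISSUES the knit's (0.4), (0.6), the leaf, the leaf at a representation datum and the
W-pinning hook on the mass proviso (§2–§3) — satisfiable, and [IV]'s own located claim (cell GAPS G-B15-01 «the densities are positive»).  For the
V-LOCAL reading (b01's `RopReal`, definer ₇'s `R` of record) the pointwise quotient needs instead the fibrewise SUPPORT condition «`∫dV⌈_{Z′}ρ(Z″,·) = 0 ⇒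
∫dV⌈_{Z′}ρ(Z,·) = 0`» — print avoids the issue altogether: the quotients 𝐑′ actually inserts ((1.100) p. 201) have denominators
`∫dV′⌈_{Λ_i} δ_{G_i}(V′)χ(Λ_i)exp[−A]` whose characteristic function (1.101) constrains the FRESH variables only, positive at every outer field (r12's
`normalization1102_of_fibreModel` displays `den ≥ c > 0`, satisfiable there).  SAID for definer ₇ ∕ dag-n12-b ∕ the referees; nothing landed is edited.

WHAT THIS FILE PROVES (0 `sorry`, 0 `def`, standard axioms).
§1 Census: `fibreIntegral_eq_zero_of_vanish` (a density vanishing on the fibre through `V` has fibre integral `0` at `V`); **`not_forall_fibreIntegral_ne_zero`**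
   (hence the pointwise proviso fails for any piece with one vanishing fibre); `fibreIntegral_indicatorOuter_eq_zero` (concretely: a piece carrying the
   indicator of an event of an un-integrated bond vanishes fibrewise off the event).
§2 Mass form of the knit: `integral_fibreIntegral_pos_of_mass`; **`normalization04_knit_of_mass`** ((0.4) ⇐ measurable ∕ ≥ 0 ∕ bounded pieces + positive mass
   of the denominators' pieces); `quot03_knit_pos_of_mass`, `quotSum_knit_pos_of_mass`, `hyp05Image_logExp_of_mass`; **`b15Leaf_knit_logExp_of_mass`**
   (the leaf at `knitW15 κ.logExp` ⇐ structural provisos + positive mass of every piece + the four displays); **`b15Leaf_knit_logExp_at_repData_of_mass`**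
   (the same read at any `d : RepData`); `b15Leaf_of_pin_knit_logExp_of_mass`.
§3 Bookkeeping: `mass_pos_of_pointwise` (the old pointwise proviso IMPLIES the mass proviso — every landed theorem's hypothesis list still discharges the
   new one; nothing is weakened in the wrong direction).
§4 The W-pin of module 8 on the mass proviso: **`b15Leaf_WOfRepr_of_mass`** (the leaf at `WOfRepr r sel fib LF D189 D1100` ⇐ measurable ∕ ≥ 0 ∕ bounded
   terms `t_a` of POSITIVE MASS + the four displays) and the N12 hook **`b15_main_of_refines₅C_WOfRepr_mass`** (N12 at every record world of any refinement
   pinning `res.W P := WOfRepr …`, run-dependent carriers, modulo the structural provisos, positive mass and EXACTLY Prop 1 (1.78), (1.80), (1.89), (1.102)).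
§5 (v1.1, APPEND-ONLY) the 𝐑′ = 𝐑-step identification on dag-n10-b's SUPPORT-form provisos (`B15FibreLemmaSupp`, p416095, by name):
   `normalization1102_of_rPrime_eq_rop_supp`, `b15Leaf_WOfRepr_of_rPrime_mass`, `b15_main_of_refines₅C_WOfRepr_rPrime_mass` — drop-ins for module 8's
   `_rPrime` theorems, whose (0.4) step used the pointwise `Provisos`.
§6 (v1.2, APPEND-ONLY) NON-VACUITY of the repaired list: `massProvisos_trivialRep_one` (at definer ₇'s one-region representation `trivialRep 1` the
   mass-form provisos hold) and `b15Leaf_at_trivialRep_one_of_displays` (so the mass-form knit hypotheses are jointly satisfiable up to the four displays — A2).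

HONEST FRAMING.  A count-neutral landing (R429 (4)(i)): a located census fact + the repaired (satisfiable) proviso form of this seat's own knit theorems;
N12 NOT discharged; the positive-mass proviso is DISPLAYED (it is [IV] p. 176's claim, to be proved at the objects of record with the positivity of
`𝐓_k e^{A_k}` and the non-emptiness of the constraint sets — [Balaban1989LargeFieldII]'s business); nothing of Bałaban's asserted or proved here; one
finite four-torus programme at fixed `ε`, Bałaban AS PRINTED with locators; nothing continuum ∕ ℝ⁴ ∕ OS ∕ mass gap ∕ Clay.
-/

noncomputable section

open scoped BigOperators ENNReal
open MeasureTheory Function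

namespace Literature.MathematicalPhysics.QuantumFieldTheory.Balaban1983to89.B15LeafKnitMass

open DagBinding T4Continuum Node00
open B15 (RData Rop Normalization04 ExpForm06 Prop1Printed Ineq180)
open B15.BasicStep (fibreIntegral Claim189)
open B15Eq06Resum (quot03 quotSum)
open B15Sect1Statements (RPrimeData Normalization1102)
open B15Claim189Assembly (Setting189 new189 chiPP dom)
open B8Eq17ClassAkV1 (plaqsOf)
open B15RopTotal (RepData)
open B15Norm1102Object (integral_fibreIntegral fibreIntegral_nonneg fibreIntegral_le measurable_fibreIntegral)
open B15LeafKnit (knitRData KnitData knitW15 b15Leaf_knit_of)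
open B15LeafKnitRecord7 (b15_main_of_refines₅C_of_leaf)
open B15LeafKnitRepr (knitOfRepr WOfRepr)

variable {P : Params} {k : ℕ} {G : Type} [GaugeGroup G] [MeasurableSpace G] [HaarData G] [DecidableEq (PBond P k)]

/-! ## §1. Census: the pointwise proviso fails at any piece with a vanishing fibre -/

section Census

/-- **A density that vanishes on the fibre through `V` has fibre integral `0` at `V`**: if `f (V with the `Z′`-variables replaced by anything) = 0`
then `∫dV⌈_{Z′} f (V) = 0` (the `lmarginal` of `ofReal ∘ f` at `V` integrates `0`). [cite: Balaban1989LargeFieldI, (0.3) p.176 (the restricted integral; bookkeeping)] -/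
theorem fibreIntegral_eq_zero_of_vanish (s : Finset (PBond P k)) {f : Density P k G} {V : GaugeField P k G}
    (hV : ∀ y : ↥s → G, f (updateFinset V s y) = 0) : fibreIntegral s f V = 0 := by
  unfold fibreIntegral
  simp only [lmarginal, hV, ENNReal.ofReal_zero, lintegral_const, zero_mul, ENNReal.toReal_zero]

/-- **The POINTWISE p. 176 proviso is refuted by one vanishing fibre**: if some field `V` has `ρ(Z″, ·) = 0` on its whole `Z′`-fibre (as Bałaban's
`χ_k(Ω_k)·𝐓_k e^{A_k}` does at a field with a large plaquette variable in `Ω_k` away from `Z′`), then «`∫dV⌈_{Z′}ρ(Z″, V) ≠ 0` for every `V`» is FALSE —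
the hypothesis `hden` of `B15.BasicStep.integral_ropReal_eq`, of `B15RopTotal.RepData.Provisos`, of `B15LeafKnit.normalization04_knit` and descendants is
then undischargeable. [cite: Balaban1989LargeFieldI, p.176 ll.14–16 («the denominators are positive»: of the OCCURRING integrals; bookkeeping census)] -/
theorem not_forall_fibreIntegral_ne_zero (s : Finset (PBond P k)) {f : Density P k G}
    (h : ∃ V : GaugeField P k G, ∀ y : ↥s → G, f (updateFinset V s y) = 0) :
    ¬ ∀ V : GaugeField P k G, fibreIntegral s f V ≠ 0 := fun hall => by
  obtain ⟨V, hV⟩ := h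
  exact hall V (fibreIntegral_eq_zero_of_vanish s hV)

/-- **Concretely**: a piece carrying the INDICATOR of an event `E` of one un-integrated bond `b ∉ Z′` (the shape of a small-field characteristic
function of a plaquette away from `Z′`) — `ρ(U) = 1_E(U b) · g(U)` — has fibre integral `0` at every field `V` with `V b ∉ E`.
[cite: Balaban1988Convergent, (2.17) p.257 (the characteristic functions); Balaban1989LargeFieldI, (0.3) p.176] -/
theorem fibreIntegral_indicatorOuter_eq_zero (s : Finset (PBond P k)) {b : PBond P k} (hb : b ∉ s) (E : Set G) [DecidablePred (· ∈ E)]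
    (g : Density P k G) {V : GaugeField P k G} (hVb : V b ∉ E) :
    fibreIntegral s (fun U => (if U b ∈ E then (1 : ℝ) else 0) * g U) V = 0 := by
  refine fibreIntegral_eq_zero_of_vanish s (fun y => ?_)
  have hb' : updateFinset V s y b = V b := by simp [updateFinset, hb]
  rw [hb', if_neg hVb, zero_mul]

/-- Hence for such a piece the pointwise proviso is false as soon as the event `E` is not all of `G` (one field with `V b ∉ E` exists: the constant field).
[cite: Balaban1989LargeFieldI, p.176 ll.14–16 (bookkeeping census)] -/
theorem not_forall_fibreIntegral_indicatorOuter_ne_zero (s : Finset (PBond P k)) {b : PBond P k} (hb : b ∉ s) (E : Set G)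
    [DecidablePred (· ∈ E)] (g : Density P k G) {u : G} (hu : u ∉ E) :
    ¬ ∀ V : GaugeField P k G, fibreIntegral s (fun U => (if U b ∈ E then (1 : ℝ) else 0) * g U) V ≠ 0 := fun hall =>
  hall (fun _ => u) (fibreIntegral_indicatorOuter_eq_zero s hb E g (V := fun _ => u) hu)

end Census

/-! ## §2. The knit on the POSITIVE-MASS proviso -/

section Mass

variable {R : Type} [Fintype R]

/-- The `∫dV`-average of a fibre integral is POSITIVE as soon as the piece has positive mass: `∫dV ∫dV⌈_{Z′} f = ∫dV f > 0` (r12's `integral_fibreIntegral`).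
This — not pointwise non-vanishing — is what the scalar (0.4) uses. [cite: Balaban1989LargeFieldI, (0.3)–(0.4) p.176] -/
theorem integral_fibreIntegral_pos_of_mass (s : Finset (PBond P k)) {f : Density P k G} (hm : Measurable f) (h0 : ∀ V, 0 ≤ f V)
    {C : ℝ} (hC : ∀ V, f V ≤ C) (hmass : 0 < ∫ V, f V ∂(fieldMeasure P k G)) :
    0 < ∫ V, fibreIntegral s f V ∂(fieldMeasure P k G) := by
  rw [integral_fibreIntegral s hm h0 hC]
  exact hmass

/-- The old POINTWISE proviso implies the mass proviso (so every landed hypothesis list still discharges the new one): if `∫dV⌈_{Z′} f` vanishes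
nowhere then `f` has positive mass. [cite: Balaban1989LargeFieldI, (0.3) p.176 (bookkeeping)] -/
theorem mass_pos_of_pointwise (s : Finset (PBond P k)) {f : Density P k G} (hm : Measurable f) (h0 : ∀ V, 0 ≤ f V) {C : ℝ}
    (hC : ∀ V, f V ≤ C) (hden : ∀ V, fibreIntegral s f V ≠ 0) : 0 < ∫ V, f V ∂(fieldMeasure P k G) := by
  rw [← integral_fibreIntegral s hm h0 hC]
  exact B15LeafKnit.integral_fibreIntegral_pos s hm h0 hC hden

omit [DecidableEq (PBond P k)] [Fintype R] in
/-- A bounded, nonnegative, measurable density is integrable over the (probability) field measure. [folklore] -/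
private theorem integrable_of_bdd {f : Density P k G} (hm : Measurable f) (h0 : ∀ V, 0 ≤ f V) {C : ℝ}
    (hC : ∀ V, f V ≤ C) : Integrable f (fieldMeasure P k G) :=
  (integrable_const C).mono' hm.aestronglyMeasurable
    (Filter.Eventually.of_forall (fun V => by rw [Real.norm_eq_abs, abs_of_nonneg (h0 V)]; exact hC V))

/-- **(0.4) AT THE KNIT DATUM ON THE MASS PROVISO** (p. 176: *"It satisfies the basic normalization property ∫dV(𝐑ρ)(V) = ∫dVρ(V)."*): pieces measurable,
nonnegative, uniformly bounded, and every denominator piece `ρ(Z″, ·)` of POSITIVE MASS `0 < ∫dV ρ(Z″, V)` — print's «the integration domains … are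
nonempty, hence the denominators are positive» in the scalar reading.  Proof: term by term `ρ(Z″,·)·(∫dVρ(Z,·)/∫dVρ(Z″,·))` integrates to `∫dVρ(Z,·)`.
[cite: Balaban1989LargeFieldI, (0.4) p.176, p.176 ll.14–16] -/
theorem normalization04_knit_of_mass (piece : R → Density P k G) (pp : R → R) (fib : R → Finset (PBond P k))
    (hm : ∀ Z, Measurable (piece Z)) (h0 : ∀ Z V, 0 ≤ piece Z V) {C : ℝ} (hC : ∀ Z V, piece Z V ≤ C)
    (hmass : ∀ Z, 0 < ∫ V, piece (pp Z) V ∂(fieldMeasure P k G)) :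
    Normalization04 (knitRData piece pp fib) := by
  have hint : ∀ Z, Integrable (piece Z) (fieldMeasure P k G) := fun Z => integrable_of_bdd (hm Z) (h0 Z) (hC Z)
  have ha : ∀ Z, (∫ V, fibreIntegral (fib Z) (piece Z) V ∂(fieldMeasure P k G)) = ∫ V, piece Z V ∂(fieldMeasure P k G) :=
    fun Z => integral_fibreIntegral (fib Z) (hm Z) (h0 Z) (hC Z)
  have hb : ∀ Z, (∫ V, fibreIntegral (fib Z) (piece (pp Z)) V ∂(fieldMeasure P k G))
      = ∫ V, piece (pp Z) V ∂(fieldMeasure P k G) :=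
    fun Z => integral_fibreIntegral (fib Z) (hm _) (h0 _) (hC _)
  have hbpos : ∀ Z, 0 < ∫ V, fibreIntegral (fib Z) (piece (pp Z)) V ∂(fieldMeasure P k G) :=
    fun Z => integral_fibreIntegral_pos_of_mass (fib Z) (hm _) (h0 _) (hC _) (hmass Z)
  show (∫ V, Rop (knitRData piece pp fib) V ∂(fieldMeasure P k G)) = ∫ V, (∑ Z, piece Z V) ∂(fieldMeasure P k G)
  have hterm : ∀ Z, Integrable (fun V => piece (pp Z) V *
      ((∫ U, fibreIntegral (fib Z) (piece Z) U ∂(fieldMeasure P k G)) /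
        (∫ U, fibreIntegral (fib Z) (piece (pp Z)) U ∂(fieldMeasure P k G)))) (fieldMeasure P k G) :=
    fun Z => (hint (pp Z)).mul_const _
  simp only [Rop, knitRData, id]
  rw [integral_finsetSum _ (fun Z _ => hterm Z), integral_finsetSum _ (fun Z _ => hint Z)]
  refine Finset.sum_congr rfl (fun Z _ => ?_)
  have hB : (∫ V, fibreIntegral (fib Z) (piece (pp Z)) V ∂(fieldMeasure P k G)) ≠ 0 := (hbpos Z).ne'
  rw [integral_mul_const, ha, ← hb Z]
  calc (∫ V, fibreIntegral (fib Z) (piece (pp Z)) V ∂(fieldMeasure P k G)) *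
        ((∫ V, piece Z V ∂(fieldMeasure P k G)) / ∫ V, fibreIntegral (fib Z) (piece (pp Z)) V ∂(fieldMeasure P k G))
      = (∫ V, piece Z V ∂(fieldMeasure P k G)) *
        ((∫ V, fibreIntegral (fib Z) (piece (pp Z)) V ∂(fieldMeasure P k G)) /
          ∫ V, fibreIntegral (fib Z) (piece (pp Z)) V ∂(fieldMeasure P k G)) := by ring
    _ = ∫ V, piece Z V ∂(fieldMeasure P k G) := by rw [div_self hB, mul_one]

/-- The (0.3)-quotient `∫dVρ(Z,·)/∫dVρ(Z″,·)` of the knit datum is POSITIVE when both pieces have positive mass. [cite: Balaban1989LargeFieldI, (0.3) p.176] -/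
theorem quot03_knit_pos_of_mass (piece : R → Density P k G) (pp : R → R) (fib : R → Finset (PBond P k))
    (hm : ∀ Z, Measurable (piece Z)) (h0 : ∀ Z V, 0 ≤ piece Z V) {C : ℝ} (hC : ∀ Z V, piece Z V ≤ C)
    (hmass : ∀ Z, 0 < ∫ V, piece Z V ∂(fieldMeasure P k G)) (Z : R) : 0 < quot03 (knitRData piece pp fib) Z :=
  div_pos (integral_fibreIntegral_pos_of_mass (fib Z) (hm Z) (h0 Z) (hC Z) (hmass Z))
    (integral_fibreIntegral_pos_of_mass (fib Z) (hm _) (h0 _) (hC _) (hmass _))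

open Classical in
/-- The (0.5)-sum of an OCCURRING region `Z″ = W` is POSITIVE on the mass proviso. [cite: Balaban1989LargeFieldI, (0.5) p.176] -/
theorem quotSum_knit_pos_of_mass (piece : R → Density P k G) (pp : R → R) (fib : R → Finset (PBond P k))
    (hm : ∀ Z, Measurable (piece Z)) (h0 : ∀ Z V, 0 ≤ piece Z V) {C : ℝ} (hC : ∀ Z V, piece Z V ≤ C)
    (hmass : ∀ Z, 0 < ∫ V, piece Z V ∂(fieldMeasure P k G)) {W : R} (hW : ∃ Z, pp Z = W) :
    0 < quotSum (knitRData piece pp fib) W := by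
  obtain ⟨Z₀, hZ₀⟩ := hW
  unfold quotSum
  refine Finset.sum_pos (fun Z _ => quot03_knit_pos_of_mass piece pp fib hm h0 hC hmass Z) ⟨Z₀, ?_⟩
  exact Finset.mem_filter.2 ⟨Finset.mem_univ _, hZ₀⟩

variable [DecidableEq R] {P₀ : Params} {C ι : Type} (κ : KnitData P k G R P₀ C ι)

/-- **(0.5) on the occurring regions HOLDS for the `log`-pinned exponents on the mass proviso** (`exp (log q) = q`, `q > 0`).
[cite: Balaban1989LargeFieldI, (0.5) p.176] -/
theorem hyp05Image_logExp_of_mass (hm : ∀ Z, Measurable (κ.piece Z)) (h0 : ∀ Z V, 0 ≤ κ.piece Z V) {Cρ : ℝ}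
    (hC : ∀ Z V, κ.piece Z V ≤ Cρ) (hmass : ∀ Z, 0 < ∫ V, κ.piece Z V ∂(fieldMeasure P k G)) :
    ∀ W ∈ Finset.univ.image κ.logExp.pp, quotSum κ.logExp.rdata W = Real.exp (κ.logExp.Rexp W) := by
  intro W hW
  obtain ⟨Z, _, hZ⟩ := Finset.mem_image.1 hW
  exact (Real.exp_log (quotSum_knit_pos_of_mass κ.piece κ.pp κ.fib hm h0 hC hmass ⟨Z, hZ⟩)).symm

/-- **THE B15 LEAF AT `knitW15 κ.logExp` ON THE MASS PROVISO**: (0.4) and (0.6) PROVED from measurable ∕ nonnegative ∕ bounded pieces of POSITIVE MASS;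
DISPLAYED exactly Proposition 1 (1.78), (1.80) on the ℍ-domains, (1.89), (1.102).  Drop-in replacement of module 2's `b15Leaf_knit_logExp_of` with its
pointwise `hnum ∕ hden` replaced by `hmass`. [cite: Balaban1989LargeFieldI, (0.4)–(0.6) p.176, Prop. 1 (1.78) p.194, (1.80) p.195, (1.89) p.198, (1.102) p.201] -/
theorem b15Leaf_knit_logExp_of_mass (hm : ∀ Z, Measurable (κ.piece Z)) (h0 : ∀ Z V, 0 ≤ κ.piece Z V) {Cρ : ℝ}
    (hC : ∀ Z V, κ.piece Z V ≤ Cρ) (hmass : ∀ Z, 0 < ∫ V, κ.piece Z V ∂(fieldMeasure P k G))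
    (hP1 : Prop1Printed κ.LF)
    (h180 : ∀ U, new189 κ.D189 U → ∀ i, κ.D189.h ≤ i → i ≤ κ.D189.k → ∀ p ∈ plaqsOf (dom κ.D189 i),
      Ineq180 (κ.D189.dev0 U p) (κ.D189.ε κ.D189.k) κ.D189.η κ.D189.B₃ κ.D189.B₅ κ.D189.M κ.D189.δ (κ.D189.dist p) κ.D189.O1)
    (h189 : Claim189 (new189 κ.D189) (chiPP κ.D189)) (h1102 : Normalization1102 κ.D1100 κ.ρk) :
    B15Leaf (knitW15 κ.logExp) where
  n04 := normalization04_knit_of_mass κ.piece κ.pp κ.fib hm h0 hC (fun Z => hmass (κ.pp Z))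
  e06 := B15LeafKnit.expForm06_of_hyp05_image κ.logExp.rdata κ.logExp.Rexp (hyp05Image_logExp_of_mass κ hm h0 hC hmass)
  p1 := hP1
  i180 := (B15LeafKnit.i180_knit_iff κ.logExp).2 h180
  c189 := h189
  e1102 := h1102

omit [Fintype R] [DecidableEq R] in
/-- **THE LEAF AT THE KNIT BUNDLE READ AT A REPRESENTATION DATUM, MASS FORM** — for any `d : B15RopTotal.RepData P k G` (definer ₇'s residual
`θ.rep p k ρ`, FILE 7's `repDataOfSel r sel fib`, …): structural provisos (measurable ∕ ≥ 0 ∕ bounded pieces) + POSITIVE MASS of every piece + the four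
displays ⇒ the leaf.  Drop-in replacement of module 7's `b15Leaf_knit_logExp_at_repData` (whose `d.Provisos ∧ hnum` carries the pointwise proviso).
[cite: Balaban1989LargeFieldI, (0.2)–(0.6) p.176, Prop. 1 (1.78) p.194, (1.80) p.195, (1.89) p.198, (1.102) p.201] -/
theorem b15Leaf_knit_logExp_at_repData_of_mass (d : RepData P k G) (hm : ∀ Z, Measurable (d.piece Z))
    (h0 : ∀ Z V, 0 ≤ d.piece Z V) {Cρ : ℝ} (hC : ∀ Z V, d.piece Z V ≤ Cρ)
    (hmass : ∀ Z, 0 < ∫ V, d.piece Z V ∂(fieldMeasure P k G))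
    (LF : B15.LFVar) (D189 : Setting189 P₀ G C ι) (D1100 : RPrimeData P k G) (ρk : Density P k G) (hP1 : Prop1Printed LF)
    (h180 : ∀ U, new189 D189 U → ∀ i, D189.h ≤ i → i ≤ D189.k → ∀ p ∈ plaqsOf (dom D189 i),
      Ineq180 (D189.dev0 U p) (D189.ε D189.k) D189.η D189.B₃ D189.B₅ D189.M D189.δ (D189.dist p) D189.O1)
    (h189 : Claim189 (new189 D189) (chiPP D189)) (h1102 : Normalization1102 D1100 ρk) :
    letI := d.fin
    letI := Classical.decEq d.Region
    B15Leaf (knitW15 (KnitData.logExp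
      ({ piece := d.piece, pp := d.pp, fib := d.fib, Rexp := fun _ => 0, LF := LF, D189 := D189, D1100 := D1100, ρk := ρk } :
        KnitData P k G d.Region P₀ C ι))) := by
  letI := d.fin
  letI := Classical.decEq d.Region
  exact b15Leaf_knit_logExp_of_mass _ hm h0 hC hmass hP1 h180 h189 h1102

/-- **The leaf at a bundle pinned to `knitW15 κ.logExp`, mass form** (module 7's `b15Leaf_of_pin_knit_logExp` on the satisfiable proviso).
[cite: Balaban1989LargeFieldI, (0.4)–(0.6) p.176, Prop. 1 (1.78) p.194, (1.80) p.195, (1.89) p.198, (1.102) p.201] -/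
theorem b15Leaf_of_pin_knit_logExp_of_mass {W : PrintedCarriers15} (hpin : W = knitW15 κ.logExp)
    (hm : ∀ Z, Measurable (κ.piece Z)) (h0 : ∀ Z V, 0 ≤ κ.piece Z V) {Cρ : ℝ} (hC : ∀ Z V, κ.piece Z V ≤ Cρ)
    (hmass : ∀ Z, 0 < ∫ V, κ.piece Z V ∂(fieldMeasure P k G)) (hP1 : Prop1Printed κ.LF)
    (h180 : ∀ U, new189 κ.D189 U → ∀ i, κ.D189.h ≤ i → i ≤ κ.D189.k → ∀ p ∈ plaqsOf (dom κ.D189 i),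
      Ineq180 (κ.D189.dev0 U p) (κ.D189.ε κ.D189.k) κ.D189.η κ.D189.B₃ κ.D189.B₅ κ.D189.M κ.D189.δ (κ.D189.dist p) κ.D189.O1)
    (h189 : Claim189 (new189 κ.D189) (chiPP κ.D189)) (h1102 : Normalization1102 κ.D1100 κ.ρk) : B15Leaf W := by
  rw [hpin]
  exact b15Leaf_knit_logExp_of_mass κ hm h0 hC hmass hP1 h180 h189 h1102

end Mass

/-! ## §4. The W-pin `WOfRepr` (module 8) on the mass proviso -/

section Repr

variable {j : ℕ} [DecidableEq (PBond P j)] {P₀ : Params} {C ι : Type}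
  (r : Step.Repr218 P G j) (sel : r.Adm → r.Adm) (fib : r.Adm → Finset (PBond P j))
  (LF : B15.LFVar) (D189 : Setting189 P₀ G C ι) (D1100 : RPrimeData P j G)

/-- **THE B15 LEAF AT THE PIN `WOfRepr r sel fib LF D189 D1100` ON THE MASS PROVISO**: the terms `t_a = χ(a)·(𝐓e^A)(a)` measurable, nonnegative, uniformly
bounded and of POSITIVE MASS `0 < ∫dV t_a` (print's «the densities are positive, … the integration domains … are nonempty»), modulo EXACTLY Proposition 1
(1.78), (1.80) on the ℍ-domains, (1.89), (1.102) at `ρ_k = Σ_a t_a`.  Drop-in replacement of module 8's `b15Leaf_WOfRepr_of` (pointwise `Provisos ∧ hnum`).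
[cite: Balaban1989LargeFieldI, (0.2)–(0.6) p.176, p.176 ll.14–16, Prop. 1 (1.78) p.194, (1.80) p.195, (1.89) p.198, (1.102) p.201] -/
theorem b15Leaf_WOfRepr_of_mass (hm : ∀ a, Measurable (rterm r a)) (h0 : ∀ a V, 0 ≤ rterm r a V) {Cρ : ℝ}
    (hC : ∀ a V, rterm r a V ≤ Cρ) (hmass : ∀ a, 0 < ∫ V, rterm r a V ∂(fieldMeasure P j G)) (hP1 : Prop1Printed LF)
    (h180 : ∀ U, new189 D189 U → ∀ i, D189.h ≤ i → i ≤ D189.k → ∀ p ∈ plaqsOf (dom D189 i),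
      Ineq180 (D189.dev0 U p) (D189.ε D189.k) D189.η D189.B₃ D189.B₅ D189.M D189.δ (D189.dist p) D189.O1)
    (h189 : Claim189 (new189 D189) (chiPP D189)) (h1102 : Normalization1102 D1100 (fun V => ∑ a, rterm r a V)) :
    B15Leaf (WOfRepr r sel fib LF D189 D1100) := by
  letI := Classical.decEq r.Adm
  exact b15Leaf_knit_logExp_of_mass (knitOfRepr r sel fib LF D189 D1100) hm h0 hC hmass hP1 h180 h189 h1102

end Repr

section Hook

variable {F : T4Family} {N : ℕ} [NeZero N] {w : WorldP}

/-- **N12 OF RECORD over any refinement pinning `res.W P := WOfRepr …`, MASS FORM** — module 8's `b15_main_of_refines₅C_WOfRepr` with the pointwise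
provisos replaced by the satisfiable ones: per admissible `θ` and run, the terms of the run's represented density are measurable, nonnegative, uniformly
bounded and of positive mass; displayed EXACTLY Proposition 1 (1.78), (1.80) on the ℍ-domains, (1.89), (1.102).  Conclusion: `Dag.B15_main (leavesP w P)` at
every run of every record world. [cite: Balaban1989LargeFieldI, Prop. 1 (1.78) p.194, (0.2)–(0.6) p.176, (1.80) p.195, (1.89) p.198, (1.102) p.201] -/
theorem b15_main_of_refines₅C_WOfRepr_mass {Θ : Type*} (toS5 : Θ → Stage5Params F N) (Adm : Θ → Prop)
    {Par : Θ → B12.RunParams → Params} {lev : Θ → B12.RunParams → ℕ} [∀ θ Pr, DecidableEq (PBond (Par θ Pr) (lev θ Pr))]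
    {P₀ : Θ → B12.RunParams → Params} {Cfg ι : Θ → B12.RunParams → Type}
    (rOf : ∀ θ Pr, Step.Repr218 (Par θ Pr) (SU N) (lev θ Pr)) (selOf : ∀ θ Pr, (rOf θ Pr).Adm → (rOf θ Pr).Adm)
    (fibOf : ∀ θ Pr, (rOf θ Pr).Adm → Finset (PBond (Par θ Pr) (lev θ Pr)))
    (LF : Θ → B12.RunParams → B15.LFVar) (D189 : ∀ θ Pr, Setting189 (P₀ θ Pr) (SU N) (Cfg θ Pr) (ι θ Pr))
    (D1100 : ∀ θ Pr, RPrimeData (Par θ Pr) (lev θ Pr) (SU N))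
    (hpin : ∀ θ, Adm θ → ∀ Pr : B12.RunParams,
      (toS5 θ).res.W Pr = WOfRepr (rOf θ Pr) (selOf θ Pr) (fibOf θ Pr) (LF θ Pr) (D189 θ Pr) (D1100 θ Pr))
    (hm : ∀ θ, Adm θ → ∀ (Pr : B12.RunParams) a, Measurable (rterm (rOf θ Pr) a))
    (h0 : ∀ θ, Adm θ → ∀ (Pr : B12.RunParams) a V, 0 ≤ rterm (rOf θ Pr) a V)
    (hC : ∀ θ, Adm θ → ∀ Pr : B12.RunParams, ∃ Cρ : ℝ, ∀ a V, rterm (rOf θ Pr) a V ≤ Cρ)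
    (hmass : ∀ θ, Adm θ → ∀ (Pr : B12.RunParams) a,
      0 < ∫ V, rterm (rOf θ Pr) a V ∂(fieldMeasure (Par θ Pr) (lev θ Pr) (SU N)))
    (hP1 : ∀ θ, Adm θ → ∀ Pr : B12.RunParams, Prop1Printed (LF θ Pr))
    (h180 : ∀ θ, Adm θ → ∀ (Pr : B12.RunParams) U, new189 (D189 θ Pr) U → ∀ i, (D189 θ Pr).h ≤ i → i ≤ (D189 θ Pr).k →
      ∀ p ∈ plaqsOf (dom (D189 θ Pr) i),
      Ineq180 ((D189 θ Pr).dev0 U p) ((D189 θ Pr).ε (D189 θ Pr).k) (D189 θ Pr).η (D189 θ Pr).B₃ (D189 θ Pr).B₅ (D189 θ Pr).M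
        (D189 θ Pr).δ ((D189 θ Pr).dist p) (D189 θ Pr).O1)
    (h189 : ∀ θ, Adm θ → ∀ Pr : B12.RunParams, Claim189 (new189 (D189 θ Pr)) (chiPP (D189 θ Pr)))
    (h1102 : ∀ θ, Adm θ → ∀ Pr : B12.RunParams, Normalization1102 (D1100 θ Pr) (fun V => ∑ a, rterm (rOf θ Pr) a V))
    (hw : ∃ θ, Adm θ ∧ ∀ Pr, w.up Pr = upOfRecord₅C F N (toS5 θ) Pr) (Pr : B12.RunParams) : Dag.B15_main (leavesP w Pr) := by
  refine b15_main_of_refines₅C_of_leaf toS5 Adm (fun θ hθ Pr => ?_) hw Pr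
  rw [hpin θ hθ Pr]
  obtain ⟨Cρ, hCρ⟩ := hC θ hθ Pr
  exact b15Leaf_WOfRepr_of_mass _ _ _ _ _ _ (hm θ hθ Pr) (h0 θ hθ Pr) hCρ (hmass θ hθ Pr) (hP1 θ hθ Pr) (h180 θ hθ Pr)
    (h189 θ hθ Pr) (h1102 θ hθ Pr)

end Hook

/-! ## §5. (v1.1) The 𝐑′ = 𝐑-step identification on the SUPPORT proviso (dag-n10-b's `B15FibreLemmaSupp`, by name) -/

section ReprSupp

open B15.BasicStep (RopReal)
open B15Sect1Statements (rPrime1100)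
open Node00 (repDataOfSel repDataOfSel_rop repDataOfSel_total)

variable {j : ℕ} [DecidableEq (PBond P j)] {P₀ : Params} {C ι : Type}
  (r : Step.Repr218 P G j) (sel : r.Adm → r.Adm) (fib : r.Adm → Finset (PBond P j))
  (LF : B15.LFVar) (D189 : Setting189 P₀ G C ι) (D1100 : RPrimeData P j G)

/-- **(1.102) from the identification 𝐑′ (1.100) = the 𝐑-step, SUPPORT FORM**: if `rPrime1100 D1100 = RopReal (rterm r) sel fib` and the terms satisfy
dag-n10-b's support-form provisos `(repDataOfSel r sel fib).ProvisosSupp` (measurable ∕ ≥ 0 ∕ bounded; «where `∫⌈_{fib a} t_{a″}` vanishes at `V`, `t_a V =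
0`» — the dischargeable reading of p. 176), then `∫dV (𝐑′ρ_k)(V) = ∫dV ρ_k(V)` for `ρ_k = Σ_a t_a` (`RepData.integral_rop_eq_of_provisosSupp`, p416095).
Drop-in for module 8's `normalization1102_of_rPrime_eq_rop` (pointwise `Provisos`). [cite: Balaban1989LargeFieldI, (1.102) p.201, (0.4) p.176] -/
theorem normalization1102_of_rPrime_eq_rop_supp (h1100 : rPrime1100 D1100 = RopReal (rterm r) sel fib)
    (hsupp : (repDataOfSel r sel fib).ProvisosSupp) : Normalization1102 D1100 (fun V => ∑ a, rterm r a V) := by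
  have h := B15RopTotal.RepData.integral_rop_eq_of_provisosSupp (repDataOfSel r sel fib) hsupp
  rw [repDataOfSel_rop, repDataOfSel_total] at h
  unfold Normalization1102
  rw [h1100]
  exact h

/-- **The leaf at the pin `WOfRepr …` with (1.102) DISCHARGED by the identification, MASS + SUPPORT FORM**: terms measurable ∕ ≥ 0 ∕ bounded ∕ of positive
mass, the support-form provisos, the identification `rPrime1100 D1100 = RopReal (rterm r) sel fib`, and EXACTLY Proposition 1 (1.78), (1.80), (1.89).
[cite: Balaban1989LargeFieldI, Prop. 1 (1.78) p.194, (1.80) p.195, (1.89) p.198, (1.100)–(1.102) p.201, (0.4) p.176] -/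
theorem b15Leaf_WOfRepr_of_rPrime_mass (hm : ∀ a, Measurable (rterm r a)) (h0 : ∀ a V, 0 ≤ rterm r a V) {Cρ : ℝ}
    (hC : ∀ a V, rterm r a V ≤ Cρ) (hmass : ∀ a, 0 < ∫ V, rterm r a V ∂(fieldMeasure P j G))
    (hsupp : (repDataOfSel r sel fib).ProvisosSupp) (hP1 : Prop1Printed LF)
    (h180 : ∀ U, new189 D189 U → ∀ i, D189.h ≤ i → i ≤ D189.k → ∀ p ∈ plaqsOf (dom D189 i),
      Ineq180 (D189.dev0 U p) (D189.ε D189.k) D189.η D189.B₃ D189.B₅ D189.M D189.δ (D189.dist p) D189.O1)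
    (h189 : Claim189 (new189 D189) (chiPP D189)) (h1100 : rPrime1100 D1100 = RopReal (rterm r) sel fib) :
    B15Leaf (WOfRepr r sel fib LF D189 D1100) :=
  b15Leaf_WOfRepr_of_mass r sel fib LF D189 D1100 hm h0 hC hmass hP1 h180 h189
    (normalization1102_of_rPrime_eq_rop_supp r sel fib D1100 h1100 hsupp)

end ReprSupp

section HookSupp

open B15.BasicStep (RopReal)
open B15Sect1Statements (rPrime1100)
open Node00 (repDataOfSel)

variable {F : T4Family} {N : ℕ} [NeZero N] {w : WorldP}

/-- **N12 OF RECORD over any refinement pinning `res.W P := WOfRepr …`, with (1.102) DISCHARGED by the 𝐑′ = 𝐑-step identification — MASS + SUPPORT FORM**: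
per admissible `θ` and run, terms measurable ∕ ≥ 0 ∕ bounded ∕ of positive mass, dag-n10-b's support-form provisos, the identification, and EXACTLY
Proposition 1 (1.78), (1.80) on the ℍ-domains, (1.89) ⇒ `Dag.B15_main (leavesP w P)` at every run of every record world.  Drop-in for module 8's
`b15_main_of_refines₅C_WOfRepr_rPrime`. [cite: Balaban1989LargeFieldI, Prop. 1 (1.78) p.194, (0.2)–(0.6) p.176, (1.80) p.195, (1.89) p.198, (1.100)–(1.102) p.201] -/
theorem b15_main_of_refines₅C_WOfRepr_rPrime_mass {Θ : Type*} (toS5 : Θ → Stage5Params F N) (Adm : Θ → Prop)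
    {Par : Θ → B12.RunParams → Params} {lev : Θ → B12.RunParams → ℕ} [∀ θ Pr, DecidableEq (PBond (Par θ Pr) (lev θ Pr))]
    {P₀ : Θ → B12.RunParams → Params} {Cfg ι : Θ → B12.RunParams → Type}
    (rOf : ∀ θ Pr, Step.Repr218 (Par θ Pr) (SU N) (lev θ Pr)) (selOf : ∀ θ Pr, (rOf θ Pr).Adm → (rOf θ Pr).Adm)
    (fibOf : ∀ θ Pr, (rOf θ Pr).Adm → Finset (PBond (Par θ Pr) (lev θ Pr)))
    (LF : Θ → B12.RunParams → B15.LFVar) (D189 : ∀ θ Pr, Setting189 (P₀ θ Pr) (SU N) (Cfg θ Pr) (ι θ Pr))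
    (D1100 : ∀ θ Pr, RPrimeData (Par θ Pr) (lev θ Pr) (SU N))
    (hpin : ∀ θ, Adm θ → ∀ Pr : B12.RunParams,
      (toS5 θ).res.W Pr = WOfRepr (rOf θ Pr) (selOf θ Pr) (fibOf θ Pr) (LF θ Pr) (D189 θ Pr) (D1100 θ Pr))
    (hm : ∀ θ, Adm θ → ∀ (Pr : B12.RunParams) a, Measurable (rterm (rOf θ Pr) a))
    (h0 : ∀ θ, Adm θ → ∀ (Pr : B12.RunParams) a V, 0 ≤ rterm (rOf θ Pr) a V)
    (hC : ∀ θ, Adm θ → ∀ Pr : B12.RunParams, ∃ Cρ : ℝ, ∀ a V, rterm (rOf θ Pr) a V ≤ Cρ)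
    (hmass : ∀ θ, Adm θ → ∀ (Pr : B12.RunParams) a,
      0 < ∫ V, rterm (rOf θ Pr) a V ∂(fieldMeasure (Par θ Pr) (lev θ Pr) (SU N)))
    (hsupp : ∀ θ, Adm θ → ∀ Pr : B12.RunParams, (repDataOfSel (rOf θ Pr) (selOf θ Pr) (fibOf θ Pr)).ProvisosSupp)
    (hP1 : ∀ θ, Adm θ → ∀ Pr : B12.RunParams, Prop1Printed (LF θ Pr))
    (h180 : ∀ θ, Adm θ → ∀ (Pr : B12.RunParams) U, new189 (D189 θ Pr) U → ∀ i, (D189 θ Pr).h ≤ i → i ≤ (D189 θ Pr).k →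
      ∀ p ∈ plaqsOf (dom (D189 θ Pr) i),
      Ineq180 ((D189 θ Pr).dev0 U p) ((D189 θ Pr).ε (D189 θ Pr).k) (D189 θ Pr).η (D189 θ Pr).B₃ (D189 θ Pr).B₅ (D189 θ Pr).M
        (D189 θ Pr).δ ((D189 θ Pr).dist p) (D189 θ Pr).O1)
    (h189 : ∀ θ, Adm θ → ∀ Pr : B12.RunParams, Claim189 (new189 (D189 θ Pr)) (chiPP (D189 θ Pr)))
    (h1100 : ∀ θ, Adm θ → ∀ Pr : B12.RunParams,
      rPrime1100 (D1100 θ Pr) = RopReal (rterm (rOf θ Pr)) (selOf θ Pr) (fibOf θ Pr))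
    (hw : ∃ θ, Adm θ ∧ ∀ Pr, w.up Pr = upOfRecord₅C F N (toS5 θ) Pr) (Pr : B12.RunParams) : Dag.B15_main (leavesP w Pr) :=
  b15_main_of_refines₅C_WOfRepr_mass toS5 Adm rOf selOf fibOf LF D189 D1100 hpin hm h0 hC hmass hP1 h180 h189
    (fun θ hθ Pr => normalization1102_of_rPrime_eq_rop_supp _ _ _ _ (h1100 θ hθ Pr) (hsupp θ hθ Pr)) hw Pr

end HookSupp

/-! ## §6. (v1.2) NON-VACUITY of the repaired proviso list: the one-region constant representation -/

section Witness

open Node00 (trivialRep)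

variable (P k G)

omit [DecidableEq (PBond P k)] in
/-- **The MASS-form provisos are SATISFIABLE** (contrast §1: the pointwise form is refuted by any χ-piece): at definer ₇'s one-region representation
`trivialRep 1` (one region `Z`, `Z″ = Z`, no fibre variables, piece `≡ 1`) the pieces are measurable, nonnegative, bounded by `1` and of mass `1 > 0`
(the field measure is a probability measure). [cite: Balaban1989LargeFieldI, (0.2) p.176, p.176 ll.14–16 (bookkeeping witness)] -/
theorem massProvisos_trivialRep_one :
    (∀ Z, Measurable ((trivialRep (fun _ : GaugeField P k G => (1 : ℝ))).piece Z)) ∧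
    (∀ Z V, 0 ≤ (trivialRep (fun _ : GaugeField P k G => (1 : ℝ))).piece Z V) ∧
    (∀ Z V, (trivialRep (fun _ : GaugeField P k G => (1 : ℝ))).piece Z V ≤ 1) ∧
    (∀ Z, 0 < ∫ V, (trivialRep (fun _ : GaugeField P k G => (1 : ℝ))).piece Z V ∂(fieldMeasure P k G)) := by
  refine ⟨fun _ => measurable_const, fun _ _ => zero_le_one, fun _ _ => le_rfl, fun _ => ?_⟩
  show 0 < ∫ _V, (1 : ℝ) ∂(fieldMeasure P k G)
  simp

variable {P k G}

/-- **Hence the hypothesis list of the mass-form knit theorems is JOINTLY SATISFIABLE up to the four printed displays**: at `trivialRep 1` the leaf at the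
knit bundle holds for ANY Proposition-1 carrier, (1.89) letters, (1.100) data and `ρ_k` satisfying EXACTLY Proposition 1 (1.78), (1.80), (1.89), (1.102)
(`b15Leaf_knit_logExp_at_repData_of_mass` at the witness) — the repaired proviso list adds no contradiction (A2). [cite: Balaban1989LargeFieldI, Prop. 1 (1.78) p.194, (1.80) p.195, (1.89) p.198, (1.102) p.201, (0.2)–(0.6) p.176 (bookkeeping witness)] -/
theorem b15Leaf_at_trivialRep_one_of_displays {P₀ : Params} {C ι : Type} (LF : B15.LFVar) (D189 : Setting189 P₀ G C ι)
    (D1100 : RPrimeData P k G) (ρk : Density P k G) (hP1 : Prop1Printed LF)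
    (h180 : ∀ U, new189 D189 U → ∀ i, D189.h ≤ i → i ≤ D189.k → ∀ p ∈ plaqsOf (dom D189 i),
      Ineq180 (D189.dev0 U p) (D189.ε D189.k) D189.η D189.B₃ D189.B₅ D189.M D189.δ (D189.dist p) D189.O1)
    (h189 : Claim189 (new189 D189) (chiPP D189)) (h1102 : Normalization1102 D1100 ρk) :
    letI := (trivialRep (fun _ : GaugeField P k G => (1 : ℝ))).fin
    letI := Classical.decEq (trivialRep (fun _ : GaugeField P k G => (1 : ℝ))).Region
    B15Leaf (knitW15 (KnitData.logExp
      ({ piece := (trivialRep (fun _ : GaugeField P k G => (1 : ℝ))).piece,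
         pp := (trivialRep (fun _ : GaugeField P k G => (1 : ℝ))).pp,
         fib := (trivialRep (fun _ : GaugeField P k G => (1 : ℝ))).fib,
         Rexp := fun _ => 0, LF := LF, D189 := D189, D1100 := D1100, ρk := ρk } :
        KnitData P k G (trivialRep (fun _ : GaugeField P k G => (1 : ℝ))).Region P₀ C ι))) := by
  obtain ⟨hm, h0, hC, hmass⟩ := massProvisos_trivialRep_one P k G
  exact b15Leaf_knit_logExp_at_repData_of_mass _ hm h0 hC hmass LF D189 D1100 ρk hP1 h180 h189 h1102

end Witness

end Literature.MathematicalPhysics.QuantumFieldTheory.Balaban1983to89.B15LeafKnitMass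

end
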